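/-
Copyright (c) 2026. All rights reserved.
Released under Apache 2.0 license as described in the file LICENSE.
Authors: abc-iut cell, prover seat abc-iut-f-028 (F fact-proving wave, tranche 28), over the statements of abc-iut-L1.
-/
import Literature.AlgebraicGeometry.Frobenioids.CharacteristicSplitting
import HarnessLib

/-!
# Frobenioids I, Def. 2.3 (a): the splitting `O^×(A) × τ(A) ⥲ O^▷(A)` — DISCHARGE of `CharacteristicSplitting.SplittingBijective`

S. Mochizuki, *The geometry of Frobenioids I: the general theory*, Kyushu J. Math. **62** (2008)
293–400 [MochizukiFrdI2008], §2, Definition 2.3, kurims p. 47: a *characteristic splitting* on `C` is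
a subfunctor in monoids `τ` of `O^▷(−)` on `(C^istr)^lin` such that "(a) for every `A ∈ Ob(C^istr)`,
the composite map `τ(A) → O^▷(A)^char` is bijective [hence determines a splitting of monoids
`O^×(A) × τ(A) ⥲ O^▷(A)`, which is functorial in `A`]" (FACT-LIST row F-0981, [FrdI] Def. 2.3 p.47).

Proof-only companion (theorems only, no new notions) of `CharacteristicSplitting.lean`, which types
Def. 2.3 as the structure `PreFrobenioid.CharacteristicSplitting F` and the bracketed consequence
"`O^×(A) × τ(A) ⥲ O^▷(A)` is bijective" as the named `Prop` fact
`CharacteristicSplitting.SplittingBijective τ`, proved there under `IsFrobenioid F`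
(`CharacteristicSplitting.splittingBijective`, via commutativity of `O^▷(A)` and total
epimorphicity).  Here the fact is PROVED FOR EVERY characteristic splitting `τ` of every functor
`F : C ⥤ F_Φ`, with no hypothesis on `F` (`splittingBijective_holds`): the two uses of the Frobenioid
axioms are replaced by the structure's own subfunctor field `res_mem` ("`O^▷(φ)` carries `τ(B)` into
`τ(A)` for linear `φ`", Prop. 2.2 (ii)(a)):

* at `φ := u ∈ O^×(A)` it says that `τ(A)` is stable under conjugation by units (`conj_mem`), which
  turns `e = t · w` (`t ∈ τ(A)`, `w ∈ O^▷(A)^× = O^×(A)`, from (a)) into `e = w · (w⁻¹ t w)` —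
  surjectivity (`splitMap_surjective_of_res`);
* at `φ := t ∈ τ(A)`, `β := 1` it says that a unit `v` with `v ∘ t = t` lies in `τ(A)`, hence (being in
  the class of `1`) equals `1` by (a) — injectivity (`splitMap_injective_of_res`), after (a) and
  `conj_mem` have identified the two `τ`-components.

No statement of `CharacteristicSplitting.lean` is edited or restated; nothing here is specific to
Frobenioids beyond Def. 2.3 itself.  no side taken on [IUTchIII] Cor 3.12; a discharged fact is OUR
kernel check of the typed sentence, not an endorsement.
-/

namespace Literature.AlgebraicGeometry.Frobenioids

open CategoryTheory

universe w v v' u u'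

namespace PreFrobenioid

variable {D : Type u} [Category.{v} D] {Φ : Dᵒᵖ ⥤ CommMonCat.{w}}
  {C : Type u'} [Category.{v'} C] {F : C ⥤ ElemFrobenioid Φ}

namespace CharacteristicSplitting

variable (τ : CharacteristicSplitting F)

/-- `τ(A)` is stable under conjugation by `O^×(A)` (for isotropic `A`): the subfunctor condition of
Def. 2.3 at the linear arrow `φ := u ∈ O^×(A)` — `t ∘ u = u ∘ (u⁻¹ ∘ t ∘ u)`, so `O^▷(u)` sends
`t ∈ τ(A)` to `u⁻¹ t u ∈ τ(A)` (written diagrammatically `u ≫ t ≫ u⁻¹`).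
[cite: MochizukiFrdI2008, Def. 2.3 p.47] -/
theorem conj_mem {A : C} (hA : IsIsotropic F A) {u : Aut A} (hu : u ∈ unitsSubgroup F A)
    {t : End A} (ht : t ∈ τ.τ A) :
    (show End A from u.hom ≫ (show A ⟶ A from t) ≫ u.inv) ∈ τ.τ A := by
  have hinv : u⁻¹ ∈ unitsSubgroup F A := (unitsSubgroup F A).inv_mem hu
  have ht' : t ∈ endSubmonoid F A := τ.τ_le hA ht
  refine τ.res_mem hA hA u.hom hu.2 t ht _ ?_ ?_
  · -- `u ≫ t ≫ u⁻¹ = (u⁻¹ · t) · u` in `End A` (`f * g = g ≫ f`)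
    have hmem : ((show End A from u.inv) * t) * (show End A from u.hom) ∈ endSubmonoid F A :=
      Submonoid.mul_mem _ (Submonoid.mul_mem _ ⟨hinv.1, hinv.2⟩ ht') ⟨hu.1, hu.2⟩
    exact hmem
  · show u.hom ≫ (show A ⟶ A from t) = (u.hom ≫ (show A ⟶ A from t) ≫ u.inv) ≫ u.hom
    rw [Category.assoc, Category.assoc, u.inv_hom_id, Category.comp_id]

/-- **Surjectivity of `O^×(A) × τ(A) → O^▷(A)` without Frobenioid axioms**: every `e ∈ O^▷(A)` is
`u · t` with `u ∈ O^×(A)`, `t ∈ τ(A)` — by (a) `e = t₀ · w` for some `t₀ ∈ τ(A)` and unit `w` of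
`O^▷(A)` (`= O^×(A)`, Prop. 2.2 (iii)), and `e = w · (w⁻¹ t₀ w)` with `w⁻¹ t₀ w ∈ τ(A)` by `conj_mem`.
[cite: MochizukiFrdI2008, Def. 2.3 p.47] -/
theorem splitMap_surjective_of_res {A : C} (hA : IsIsotropic F A) :
    Function.Surjective (τ.splitMap hA) := by
  intro e
  obtain ⟨t, ht⟩ := (τ.bijective hA).2 (Associates.mk e)
  obtain ⟨w, hw⟩ := Associates.mk_eq_mk_iff_associated.mp ht
  obtain ⟨α, hα, hαw⟩ := (isUnit_endSubmonoid_iff F (w : endSubmonoid F A)).mp w.isUnit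
  refine ⟨(⟨α, hα⟩, ⟨_, τ.conj_mem hA hα t.2⟩), ?_⟩
  apply Subtype.ext
  rw [← hw]
  show (α.hom ≫ (show A ⟶ A from t.1) ≫ α.inv) ≫ α.hom =
    (show A ⟶ A from (w : endSubmonoid F A).1) ≫ (show A ⟶ A from t.1)
  rw [← hαw, Category.assoc, Category.assoc, α.inv_hom_id, Category.comp_id]

/-- **Injectivity of `O^×(A) × τ(A) → O^▷(A)` without Frobenioid axioms**: if `u · t = u' · t'` then,
with `v := u'⁻¹ u ∈ O^×(A)`, `t' = v t`; by `conj_mem`, `v⁻¹ t' v = t v ∈ τ(A)` lies in the class of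
`t`, so `t v = t` by (a); the subfunctor condition at `φ := t`, `β := 1` then puts `v` in `τ(A)`, in the
class of `1`, so `v = 1` by (a): `u = u'` and `t = t'`. [cite: MochizukiFrdI2008, Def. 2.3 p.47] -/
theorem splitMap_injective_of_res {A : C} (hA : IsIsotropic F A) :
    Function.Injective (τ.splitMap hA) := by
  rintro ⟨u, t⟩ ⟨u', t'⟩ h
  have ht : (t.1 : End A) ∈ endSubmonoid F A := τ.τ_le hA t.2
  -- the underlying equation `t ≫ u = t' ≫ u'`
  have h1 : (show A ⟶ A from t.1) ≫ u.1.hom = (show A ⟶ A from t'.1) ≫ u'.1.hom :=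
    congrArg (fun e : endSubmonoid F A => (show A ⟶ A from e.1)) h
  -- the unit `v := u'⁻¹ u`, diagrammatically `u ≫ u'⁻¹`
  set v : Aut A := u'.1⁻¹ * u.1 with hvdef
  have hv : v ∈ unitsSubgroup F A := (unitsSubgroup F A).mul_mem ((unitsSubgroup F A).inv_mem u'.2) u.2
  have hvhom : v.hom = u.1.hom ≫ u'.1.inv := rfl
  -- `t' = t ≫ v`
  have h2 : (show A ⟶ A from t'.1) = (show A ⟶ A from t.1) ≫ v.hom := by
    rw [hvhom, ← Category.assoc, h1, Category.assoc, u'.1.hom_inv_id, Category.comp_id]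
  -- `v ≫ t' ≫ v⁻¹ = v ≫ t ∈ τ(A)`
  have h3 : (show End A from v.hom ≫ (show A ⟶ A from t.1)) ∈ τ.τ A := by
    have := τ.conj_mem hA hv t'.2
    have heq : v.hom ≫ (show A ⟶ A from t'.1) ≫ v.inv = v.hom ≫ (show A ⟶ A from t.1) := by
      rw [h2, Category.assoc, v.hom_inv_id, Category.comp_id]
    rw [heq] at this
    exact this
  -- the unit of `O^▷(A)` underlying `v`
  obtain ⟨c, hc⟩ := (isUnit_endSubmonoid_iff F (⟨v.hom, hv.1, hv.2⟩ : endSubmonoid F A)).mpr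
    ⟨v, hv, rfl⟩
  -- `v ≫ t` lies in the class of `t`, hence equals `t` by (a)
  have h4 : (show A ⟶ A from t.1) = v.hom ≫ (show A ⟶ A from t.1) := by
    have hcls : Associates.mk (⟨t.1, ht⟩ : endSubmonoid F A) =
        Associates.mk (⟨v.hom ≫ (show A ⟶ A from t.1), τ.τ_le hA h3⟩ : endSubmonoid F A) := by
      rw [Associates.mk_eq_mk_iff_associated]
      refine ⟨c, Subtype.ext ?_⟩
      show (show A ⟶ A from (c : endSubmonoid F A).1) ≫ (show A ⟶ A from t.1) =
        v.hom ≫ (show A ⟶ A from t.1)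
      rw [hc]
    have := (τ.bijective hA).1 (a₁ := ⟨t.1, t.2⟩) (a₂ := ⟨_, h3⟩) hcls
    exact congrArg (fun s : τ.τ A => (show A ⟶ A from s.1)) this
  -- the subfunctor condition at `φ := t`, `β := 1`: `v ∈ τ(A)`
  have h5 : (show End A from v.hom) ∈ τ.τ A := by
    refine τ.res_mem hA hA (show A ⟶ A from t.1) ht.2 1 (τ.τ A).one_mem v.hom ⟨hv.1, hv.2⟩ ?_
    show (show A ⟶ A from t.1) ≫ 𝟙 A = v.hom ≫ (show A ⟶ A from t.1)
    rw [Category.comp_id]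
    exact h4
  -- `v` lies in the class of `1`, hence `v = 1` by (a)
  have h6 : v.hom = 𝟙 A := by
    have hcls : Associates.mk (1 : endSubmonoid F A) =
        Associates.mk (⟨v.hom, hv.1, hv.2⟩ : endSubmonoid F A) := by
      rw [Associates.mk_eq_mk_iff_associated]
      exact ⟨c, by rw [one_mul, hc]⟩
    have := (τ.bijective hA).1 (a₁ := ⟨1, (τ.τ A).one_mem⟩) (a₂ := ⟨v.hom, h5⟩) hcls
    exact (congrArg (fun s : τ.τ A => (show A ⟶ A from s.1)) this).symm
  -- conclude
  have hu : u.1 = u'.1 := by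
    apply Iso.ext
    have : u.1.hom ≫ u'.1.inv = 𝟙 A := hvhom ▸ h6
    calc u.1.hom = (u.1.hom ≫ u'.1.inv) ≫ u'.1.hom := by
          rw [Category.assoc, u'.1.inv_hom_id, Category.comp_id]
      _ = u'.1.hom := by rw [this, Category.id_comp]
  have htt : t = t' := by
    apply Subtype.ext
    have : (show A ⟶ A from t'.1) = (show A ⟶ A from t.1) := by rw [h2, h6, Category.comp_id]
    exact this.symm
  rw [Prod.mk.injEq]
  exact ⟨Subtype.ext hu, htt⟩

/-- **Def. 2.3 (a) DISCHARGED** (FACT-LIST F-0981, [FrdI] Def. 2.3 p.47): "[hence determines a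
splitting of monoids `O^×(A) × τ(A) ⥲ O^▷(A)`]" — the splitting map `(u, t) ↦ u · t` is a bijection
for every isotropic `A`, for EVERY characteristic splitting `τ` of every `F : C ⥤ F_Φ` (no Frobenioid
hypothesis; cf. `splittingBijective`, the Frobenioid case). [cite: MochizukiFrdI2008, Def. 2.3 p.47] -/
theorem splittingBijective_holds :
    Literature.AlgebraicGeometry.Frobenioids.PreFrobenioid.CharacteristicSplitting.SplittingBijective τ :=
  fun hA => ⟨τ.splitMap_injective_of_res hA, τ.splitMap_surjective_of_res hA⟩

/-- `SplittingBijective` — `_holds` alias of `splittingBijective_holds` above under the fact's exact name (appended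
2026-08-28, D-0026 bookkeeping: the proof term is the existing theorem of this file; no statement,
definition or attribute is edited; no new named fact; the ledger's debt table listed the fact
unproved). [cite: MochizukiFrdI2008, Def. 2.3 p.47] -/
theorem _root_.Literature.AlgebraicGeometry.Frobenioids.PreFrobenioid.CharacteristicSplitting.SplittingBijective_holds :
    Literature.AlgebraicGeometry.Frobenioids.PreFrobenioid.CharacteristicSplitting.SplittingBijective τ :=
  _root_.Literature.AlgebraicGeometry.Frobenioids.PreFrobenioid.CharacteristicSplitting.splittingBijective_holds (τ := τ)

/-- The universal closure of the FACT-LIST row F-0981 over all its binders `D, Φ, C, F, τ`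
(kernel-closed form of `splittingBijective_holds`). [cite: MochizukiFrdI2008, Def. 2.3 p.47] -/
theorem forall_splittingBijective :
    ∀ {D : Type u} [Category.{v} D] {Φ : Dᵒᵖ ⥤ CommMonCat.{w}} {C : Type u'} [Category.{v'} C]
      {F : C ⥤ ElemFrobenioid Φ} (τ : CharacteristicSplitting F),
      Literature.AlgebraicGeometry.Frobenioids.PreFrobenioid.CharacteristicSplitting.SplittingBijective τ :=
  fun τ => τ.splittingBijective_holds

end CharacteristicSplitting

end PreFrobenioid

end Literature.AlgebraicGeometry.Frobenioids
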